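import Summits.RiemannHypothesis.RiemannHypothesis.Theses.PluckedString
import Literature.NumberTheory.LFunctions.ZetaScrewThm17Proofs

/-! Sketch for crux idea `hankel-growth-split` (D16 of the strategy census): first-lemma signatures, defs only. -/

noncomputable section
open scoped BigOperators
open MeasureTheory Literature.NumberTheory.LFunctions

namespace Summit.RiemannHypothesis.RiemannHypothesis.Cruxes.StringThesis.HankelGrowthSplit
open Summit.RiemannHypothesis.RiemannHypothesis.Theses.PluckedString (StringThesis)

def screwMoment (n : ℕ) : ℝ :=
  ∫ t in Set.Ioi (0 : ℝ), 4⁻¹ * Real.exp (-t / 2) * zetaScrew t * t ^ n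

def HankelPSD : Prop :=
  ∀ (n : ℕ) (a : Fin (n + 1) → ℝ), 0 ≤ ∑ i, ∑ j, a i * a j * screwMoment ((i : ℕ) + j)

def GrowthLT (κ : ℝ) : Prop := ∃ C : ℝ, ∀ t : ℝ, |zetaScrew t| ≤ C * Real.exp (κ * |t|)

/-- First lemma (L1): under the growth piece the moment integrands are integrable (no Bochner junk) and the
absolute moments grow at most factorially-geometrically — the Carleman input. -/
def FirstLemma : Prop :=
  ∀ κ : ℝ, κ < 1 / 2 → GrowthLT κ → ∃ A B : ℝ, 0 < B ∧ ∀ n : ℕ,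
    IntegrableOn (fun t : ℝ => Real.exp (-t / 2) * |zetaScrew t| * t ^ n) (Set.Ioi 0) ∧
      ∫ t in Set.Ioi (0 : ℝ), Real.exp (-t / 2) * |zetaScrew t| * t ^ n ≤ A * B ^ n * n.factorial

/-- Second lemma (L2, the analysis heart): polynomial density in the weighted L² space, stated without measure-theoretic
packaging — if `f` is square-integrable against `w = e^{-t/2}|Ψ|` and orthogonal to all monomials, it vanishes `w`-a.e. -/
def SecondLemma : Prop :=
  ∀ κ : ℝ, κ < 1 / 2 → GrowthLT κ → ∀ f : ℝ → ℝ, Measurable f →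
    IntegrableOn (fun t => f t ^ 2 * (Real.exp (-t / 2) * |zetaScrew t|)) (Set.Ioi 0) →
    (∀ n : ℕ, ∫ t in Set.Ioi (0 : ℝ), f t * t ^ n * (Real.exp (-t / 2) * |zetaScrew t|) = 0) →
    ∀ᵐ t ∂(volume.restrict (Set.Ioi (0 : ℝ))), f t * (Real.exp (-t / 2) * |zetaScrew t|) = 0

/-- Third lemma (L3): Hankel positivity + density ⇒ `Ψ ≥ 0` on `(0, ∞)`. -/
def ThirdLemma : Prop :=
  ∀ κ : ℝ, κ < 1 / 2 → GrowthLT κ → HankelPSD → ∀ t : ℝ, 0 < t → 0 ≤ zetaScrew t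

/-- Endgame (landed in `StrategistCensus.stringThesis_of_nonneg_on_pos`). -/
theorem stringThesis_of_thirdLemma (h3 : ThirdLemma) {κ : ℝ} (hκ : κ < 1 / 2) (hG : GrowthLT κ)
    (hH : HankelPSD) : StringThesis := by
  intro N t x
  have hpos : ∀ s : ℝ, 0 ≤ zetaScrew s := by
    intro s
    rcases lt_trichotomy s 0 with hs | rfl | hs
    · simpa using h3 κ hκ hG hH (-s) (by linarith)
    · simp [zetaScrew_zero]
    · exact h3 κ hκ hG hH s hs
  exact ((Suzuki2023_thm12.iff_real Suzuki2023_thm12_holds).1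
    (riemannHypothesis_of_zetaScrew_nonneg hpos)) N t x

end Summit.RiemannHypothesis.RiemannHypothesis.Cruxes.StringThesis.HankelGrowthSplit
end
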